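import Mathlib
import Literature.Probability.RandomPlanarGeometry.HexSAW
import Literature.Probability.LatticeModels.AnchoredClusterExpansion
import Literature.Probability.LatticeModels.PolymerGasGeometric
import Summits.CriticalPhenomena.SAWScalingLimit.Theses.SAWMassiveIsingTilt
import Summits.CriticalPhenomena.SAWScalingLimit.Theorems.SAWMassiveIsingTiltDefs
import Summits.CriticalPhenomena.SAWScalingLimit.Theorems.SAWMassiveIsingTiltTiltLawBasic
import Summits.CriticalPhenomena.SAWScalingLimit.Theorems.SAWMassiveIsingTiltCriticalCurveContinuityZloopPolymerGas
import Summits.CriticalPhenomena.SAWScalingLimit.Theorems.SAWMassiveIsingTiltCriticalCurveContinuityIsSmallActivityLoopActivity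

/-!
# Restriction from mass in the Kotecký–Preiss regime (route `SAWMassiveIsingTilt`)

Route `SAWMassiveIsingTilt` of `CriticalPhenomena/SAWScalingLimit`; lead prover (c3) of the line
`registered` of the crux `CriticalCurveContinuity` (stmt-CriticalPhenomena-7686), cycle 3, sub-goal
S-E `zloop_restrictionDefect_le_smallFugacity`.

**Statement.** There is `y₀ > 0` such that for every `y ∈ [0, y₀]`, every Dobrushin domain `D`,
mesh `δ > 0`, vertex set `S ⊆ V := vertices of Ω_δ` and hexagonal SAW `γ` of `Ω_δ` with vertices
`T ⊆ S`,
`|log( Zloop(Ω_δ, V∖T; y)·Zloop(Ω_δ, S; y) / (Zloop(Ω_δ, S∖T; y)·Zloop(Ω_δ, V; y)) )|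
   ≤ Σ_{v ∈ γ} Σ_{w ∈ V∖S} exp(−½·d_Hex(v, w))`
— literally the body of the route crux `RestrictionFromMass` (stmt-CriticalPhenomena-7687) with
`C = 1`, `c = ½`, for `y` in the Kotecký–Preiss regime (its layer-2 "SmallFugacity" half), and the
bath-locality input ("finite-range remainder") of the score decoupling mechanism of
`CriticalCurveContinuity`.

**Proof.** By the landed `zloop_eq_polymerPartitionFunction` (p154156) each `Zloop(Ω_δ, S'; y)` is
the partition function of the subset-polymer gas of connected even subgraphs on the volume
`𝒫(T_{S'})`; removing the walk's vertices removes exactly the polymers meeting `T`, so by the tree's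
proved cluster expansion (`polymerPartitionFunction_sdiff_div_eq_exp`, [KP86, (5)]) both ratios
`Z(V∖T)/Z(V)`, `Z(S∖T)/Z(S)` are exponentials of minus the truncated-functional sums over the
clusters meeting `T`, inside `𝒫(T_V)` resp. `𝒫(T_S)`. Their quotient is the sum over clusters
meeting `T` and containing a polymer not inside `S`, i.e. whose support contains some `v ∈ γ` and
some `w ∈ V ∖ S`; such a cluster with non-zero truncated functional has hexagonally connected
support, hence total size `> d_Hex(v, w)` (`IsSmallActivity.height_lt_of_mem_clusterSupp`), and the
anchored tail bound `IsSmallActivity.sum_norm_truncatedWeight_anchored_ge_le` ([KP86, (4)] at the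
one-site polymer `{v}`) bounds their total weight by `e^{−½ d_Hex(v,w)}`. The smallness of the
activities for `|y| ≤ y₀` is the landed `isSmallActivity_loopActivity`.
-/

noncomputable section

open Finset Filter Topology
open Literature.Probability Literature.Probability.LatticeModels
  Literature.Probability.RandomPlanarGeometry
open Summit.CriticalPhenomena.SAWScalingLimit.Theses.SAWMassiveIsingTilt
open Summit.CriticalPhenomena.SAWScalingLimit.Theorems.ObservableToSLE.Negative
  (finite_embMeshVertices_hex)
open scoped Classical

namespace Summit.CriticalPhenomena.SAWScalingLimit.Theorems.SAWMassiveIsingTilt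

/-! ### Volumes: removing the walk's vertices removes the polymers meeting it -/

/-- The polymers of `T_{X ∖ Y}` are the polymers of `T_X` not meeting `Y` (decidability instances
are implicit arguments, so that the lemma rewrites terms carrying arbitrary instances). -/
theorem powerset_filter_mem_diff (W : Finset HexVertex) (X Y : Set HexVertex)
    {_i₁ : DecidablePred fun v : HexVertex => v ∈ X \ Y} {_i₂ : DecidablePred fun v : HexVertex => v ∈ X}
    {_i₃ : DecidablePred fun A : Finset HexVertex => ∃ v ∈ A, v ∈ Y} :
    (W.filter fun v => v ∈ X \ Y).powerset =
      (W.filter fun v => v ∈ X).powerset \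
        (W.filter fun v => v ∈ X).powerset.filter fun A => ∃ v ∈ A, v ∈ Y := by
  ext A
  simp only [Finset.mem_powerset, Finset.mem_sdiff, Finset.mem_filter, Finset.subset_iff,
    Set.mem_sdiff, not_and, not_exists]
  constructor
  · intro h
    exact ⟨fun a ha => ⟨(h ha).1, (h ha).2.1⟩, fun _ a ha hy => (h ha).2.2 hy⟩
  · rintro ⟨h1, h2⟩ a ha
    exact ⟨(h1 ha).1, (h1 ha).2, h2 h1 a ha⟩

/-- Shrinking the ambient family of the deleted polymers does not change the deletion. -/
theorem powerset_sdiff_filter_eq_of_subset {TS TV : Finset HexVertex} (hST : TS ⊆ TV)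
    (P : Finset HexVertex → Prop) {_i : DecidablePred P} :
    TS.powerset \ TS.powerset.filter P = TS.powerset \ TV.powerset.filter P := by
  ext A
  simp only [Finset.mem_sdiff, Finset.mem_powerset, Finset.mem_filter, not_and]
  constructor
  · rintro ⟨hA, h⟩
    exact ⟨hA, fun _ => h hA⟩
  · rintro ⟨hA, h⟩
    exact ⟨hA, fun _ => h (hA.trans hST)⟩

/-! ### Supports of polymers with non-zero activity are hexagonally connected -/

/-- A walk in the graph spanned by an edge set `E ⊆ E(ℍ)` is a chain of hexagonal steps inside the
support of `E`. -/
theorem reflTransGen_of_reachable_fromEdgeSet {E : Finset (Sym2 HexVertex)}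
    (hE : ∀ e ∈ E, e ∈ hexGraph.edgeSet) {u w : HexVertex}
    (h : (SimpleGraph.fromEdgeSet ((E : Finset (Sym2 HexVertex)) : Set (Sym2 HexVertex))).Reachable u w) :
    Relation.ReflTransGen
      (fun x y => hexGraph.Adj x y ∧ x ∈ E.biUnion Sym2.toFinset ∧ y ∈ E.biUnion Sym2.toFinset) u w := by
  obtain ⟨p⟩ := h
  induction p with
  | nil => exact Relation.ReflTransGen.refl
  | @cons a b c hab _ ih =>
    rw [SimpleGraph.fromEdgeSet_adj, Finset.mem_coe] at hab
    have hadj : hexGraph.Adj a b := by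
      have := hE _ hab.1
      rwa [SimpleGraph.mem_edgeSet] at this
    refine Relation.ReflTransGen.head ⟨hadj, ?_, ?_⟩ ih
    · exact Finset.mem_biUnion.2 ⟨_, hab.1, Sym2.mem_toFinset.2 (Sym2.mem_mk_left a b)⟩
    · exact Finset.mem_biUnion.2 ⟨_, hab.1, Sym2.mem_toFinset.2 (Sym2.mem_mk_right a b)⟩

/-- A polymer with non-zero connected-even-subgraph activity is hexagonally connected
(`IsRConnected hexGraph.Adj`). -/
theorem isRConnected_of_loopActivity_ne_zero {EH : Finset (Sym2 HexVertex)}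
    (hEH : ∀ e ∈ EH, e ∈ hexGraph.edgeSet) (z : ℂ) (A : Finset HexVertex)
    (hA : (∑ E ∈ EH.powerset with (E.biUnion Sym2.toFinset = A ∧ A.Nonempty ∧
        (∀ u : HexVertex, Even (E.filter (fun e => u ∈ e)).card) ∧
        ∀ u ∈ A, ∀ w ∈ A,
          (SimpleGraph.fromEdgeSet ((E : Finset (Sym2 HexVertex)) : Set (Sym2 HexVertex))).Reachable u w),
        z ^ E.card) ≠ 0) :
    IsRConnected hexGraph.Adj A := by
  obtain ⟨E, hE, -⟩ := Finset.exists_ne_zero_of_sum_ne_zero hA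
  obtain ⟨hEEH, hsupp, hne, -, hconn⟩ := Finset.mem_filter.1 hE
  have hE' : ∀ e ∈ E, e ∈ hexGraph.edgeSet := fun e he => hEH e (Finset.mem_powerset.1 hEEH he)
  refine ⟨hne, fun v hv w hw => ?_⟩
  have h := reflTransGen_of_reachable_fromEdgeSet hE' (hconn v hv w hw)
  rwa [hsupp] at h

/-! ### The bound on the clusters through `v` reaching `w` -/

/-- **Clusters anchored at `v` whose support contains `w` weigh at most `e^{-½ d_Hex(v,w)}`**
(one-site KP smallness with `δ = ½`, activities supported on hexagonally connected polymers). -/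
theorem sum_norm_truncatedWeight_through_le {ρ : Finset HexVertex → ℂ} (hρ : IsSmallActivity ρ (1 / 2))
    (hconn : ∀ A, ρ A ≠ 0 → IsRConnected hexGraph.Adj A) (𝒞 : Finset (Finset (Finset HexVertex)))
    (v w : HexVertex) :
    ∑ C ∈ 𝒞 with (v ∈ clusterSupp C ∧ w ∈ clusterSupp C), ‖truncatedWeight polyInc ρ C‖ ≤
      Real.exp (-((1 / 2) * (hexGraph.dist v w : ℝ))) := by
  have hlip : ∀ a b : HexVertex, hexGraph.Adj a b → hexGraph.dist v b ≤ hexGraph.dist v a + 1 := by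
    intro a b hab
    rcases hab.diff_dist_adj (u := v) with h | h | h <;> omega
  -- drop the clusters with vanishing truncated functional, then use the anchored tail bound
  calc ∑ C ∈ 𝒞 with (v ∈ clusterSupp C ∧ w ∈ clusterSupp C), ‖truncatedWeight polyInc ρ C‖
      = ∑ C ∈ 𝒞 with (v ∈ clusterSupp C ∧ w ∈ clusterSupp C ∧ truncatedWeight polyInc ρ C ≠ 0),
          ‖truncatedWeight polyInc ρ C‖ := by
        symm
        refine Finset.sum_subset (fun C hC => ?_) (fun C hC hC' => ?_)
        · simp only [Finset.mem_filter] at hC ⊢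
          exact ⟨hC.1, hC.2.1, hC.2.2.1⟩
        · simp only [Finset.mem_filter, not_and, not_not] at hC hC'
          rw [hC' hC.1 hC.2.1 hC.2.2, norm_zero]
    _ ≤ ∑ C ∈ 𝒞 with (v ∈ clusterSupp C ∧ ((hexGraph.dist v w + 1 : ℕ) : ℝ) ≤ ∑ A ∈ C, (A.card : ℝ)),
          ‖truncatedWeight polyInc ρ C‖ := by
        refine Finset.sum_le_sum_of_subset_of_nonneg (fun C hC => ?_) (fun _ _ _ => norm_nonneg _)
        simp only [Finset.mem_filter] at hC ⊢
        refine ⟨hC.1, hC.2.1, ?_⟩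
        have hlt := hρ.height_lt_of_mem_clusterSupp (R := hexGraph.Adj) hconn hlip hC.2.2.2 hC.2.1
          (SimpleGraph.dist_self (G := hexGraph) (v := v)) hC.2.2.1
        exact_mod_cast Nat.succ_le_of_lt hlt
    _ ≤ Real.exp (-((1 / 2) * ((hexGraph.dist v w + 1 : ℕ) : ℝ))) :=
        hρ.sum_norm_truncatedWeight_anchored_ge_le v 𝒞 _
    _ ≤ Real.exp (-((1 / 2) * (hexGraph.dist v w : ℝ))) := by
        rw [Real.exp_le_exp]
        push_cast
        linarith

/-- Domination of the sum over the clusters meeting `T` and `U` by the double sum over anchor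
pairs `(v, w) ∈ T × U` of the sums over the clusters through `v` and `w`. -/
theorem sum_filter_meets_le_sum_sum {𝒞 𝒟 : Finset (Finset (Finset HexVertex))} (h𝒟 : 𝒟 ⊆ 𝒞)
    (T U : Finset HexVertex) (g : Finset (Finset HexVertex) → ℝ) (hg : ∀ C, 0 ≤ g C)
    (hmeet : ∀ C ∈ 𝒟, ∃ v ∈ T, ∃ w ∈ U, v ∈ clusterSupp C ∧ w ∈ clusterSupp C) :
    ∑ C ∈ 𝒟, g C ≤ ∑ v ∈ T, ∑ w ∈ U, ∑ C ∈ 𝒞 with (v ∈ clusterSupp C ∧ w ∈ clusterSupp C), g C := by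
  calc ∑ C ∈ 𝒟, g C
      ≤ ∑ C ∈ 𝒟, ∑ p ∈ T ×ˢ U, (if p.1 ∈ clusterSupp C ∧ p.2 ∈ clusterSupp C then g C else 0) := by
        refine Finset.sum_le_sum fun C hC => ?_
        obtain ⟨v, hv, w, hw, hvC, hwC⟩ := hmeet C hC
        have h := Finset.single_le_sum (s := T ×ˢ U)
          (f := fun p => if p.1 ∈ clusterSupp C ∧ p.2 ∈ clusterSupp C then g C else 0)
          (fun p _ => ite_nonneg (hg C) le_rfl) (Finset.mk_mem_product hv hw)
        simpa [hvC, hwC] using h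
    _ ≤ ∑ C ∈ 𝒞, ∑ p ∈ T ×ˢ U, (if p.1 ∈ clusterSupp C ∧ p.2 ∈ clusterSupp C then g C else 0) :=
        Finset.sum_le_sum_of_subset_of_nonneg h𝒟 fun C _ _ =>
          Finset.sum_nonneg fun _ _ => ite_nonneg (hg C) le_rfl
    _ = ∑ p ∈ T ×ˢ U, ∑ C ∈ 𝒞, (if p.1 ∈ clusterSupp C ∧ p.2 ∈ clusterSupp C then g C else 0) :=
        Finset.sum_comm
    _ = ∑ v ∈ T, ∑ w ∈ U, ∑ C ∈ 𝒞 with (v ∈ clusterSupp C ∧ w ∈ clusterSupp C), g C := by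
        rw [Finset.sum_product]
        refine Finset.sum_congr rfl fun v _ => Finset.sum_congr rfl fun w _ => ?_
        rw [Finset.sum_filter]

/-- **Sub-goal S-E of the line (cycle 3): RESTRICTION FROM MASS IN THE KOTECKÝ–PREISS REGIME.**
There is `y₀ > 0` such that for every `y ∈ [0, y₀]` the restriction defect of the route crux
`RestrictionFromMass` (stmt-CriticalPhenomena-7687) holds with `C = 1`, `c = ½`: for every Dobrushin
domain, mesh `δ > 0`, `S ⊆ V = vertices of Ω_δ` and hexagonal SAW `γ` with vertices `T ⊆ S`,
`|log(Zloop(V∖T)·Zloop(S)/(Zloop(S∖T)·Zloop(V)))| ≤ Σ_{v ∈ γ} Σ_{w ∈ V∖S} e^{−½ d_Hex(v,w)}`. -/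
theorem zloop_restrictionDefect_le_smallFugacity : ∃ y₀ : ℝ, 0 < y₀ ∧
    ∀ y ∈ Set.Icc (0 : ℝ) y₀, ∃ C c : ℝ, 0 < c ∧
      ∀ (D : DobrushinDomain) (δ : ℝ), 0 < δ →
        ∀ (S : Set HexVertex) (a b : HexVertex) (γ : SAW.HexDomainSAW D.carrier δ a b),
          (∀ v ∈ γ.walk.support, v ∈ S) →
            S ⊆ SAW.embMeshDomain hexGraph hexCenter D.carrier δ →
              |Real.log ((Zloop (SAW.hexDomainGraph D.carrier δ)
                    (SAW.embMeshDomain hexGraph hexCenter D.carrier δ \ {v | v ∈ γ.walk.support}) y *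
                  Zloop (SAW.hexDomainGraph D.carrier δ) S y) /
                (Zloop (SAW.hexDomainGraph D.carrier δ) (S \ {v | v ∈ γ.walk.support}) y *
                  Zloop (SAW.hexDomainGraph D.carrier δ)
                    (SAW.embMeshDomain hexGraph hexCenter D.carrier δ) y))| ≤
                C * ∑ v ∈ γ.walk.support.toFinset,
                  ∑ᶠ w ∈ SAW.embMeshDomain hexGraph hexCenter D.carrier δ \ S,
                    Real.exp (-(c * (hexGraph.dist v w : ℝ))) := by
  obtain ⟨y₀, hy₀, hsmallAll⟩ := isSmallActivity_loopActivity
  refine ⟨y₀, hy₀, fun y hy => ⟨1, 1 / 2, one_half_pos, fun D δ hδ S a b γ hγS hSV => ?_⟩⟩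
  have hΩ : Bornology.IsBounded D.carrier := D.isBounded
  have hδ0 : δ ≠ 0 := ne_of_gt hδ
  -- notation
  set H := SAW.hexDomainGraph D.carrier δ with hH
  set V : Set HexVertex := SAW.embMeshDomain hexGraph hexCenter D.carrier δ with hV
  set Tγ : Set HexVertex := {v | v ∈ γ.walk.support} with hTγ
  set EH : Finset (Sym2 HexVertex) := (finite_edgeSet_hexDomainGraph hΩ hδ0).toFinset with hEH
  set W : Finset HexVertex := EH.biUnion Sym2.toFinset with hW
  set ρ : Finset HexVertex → ℂ := fun A => ∑ E ∈ EH.powerset with (E.biUnion Sym2.toFinset = A ∧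
      A.Nonempty ∧ (∀ u : HexVertex, Even (E.filter (fun e => u ∈ e)).card) ∧
      ∀ u ∈ A, ∀ w ∈ A,
        (SimpleGraph.fromEdgeSet ((E : Finset (Sym2 HexVertex)) : Set (Sym2 HexVertex))).Reachable u w),
    (y : ℂ) ^ E.card with hρ
  have hEHhex : ∀ e ∈ EH, e ∈ hexGraph.edgeSet := by
    intro e he
    rw [hEH, Set.Finite.mem_toFinset] at he
    exact SimpleGraph.edgeSet_mono (SAW.embDomainGraph_le hexGraph hexCenter D.carrier δ) he
  have hsmall : IsSmallActivity ρ (1 / 2) :=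
    hsmallAll EH hEHhex (y : ℂ) (by rw [Complex.norm_real, Real.norm_eq_abs, abs_of_nonneg hy.1]; exact hy.2)
  have hconn : ∀ A, ρ A ≠ 0 → IsRConnected hexGraph.Adj A :=
    fun A hA => isRConnected_of_loopActivity_ne_zero hEHhex (y : ℂ) A hA
  -- the four partition functions (`T_{S'}` = vertices of `E(Ω_δ)` in `S'`)
  have hZ : ∀ S' : Set HexVertex, ((Zloop H S' y : ℝ) : ℂ) =
      polymerPartitionFunction polyInc ρ (W.filter fun v => v ∈ S').powerset :=
    fun S' => zloop_eq_polymerPartitionFunction hΩ hδ0 S' y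
  have hTST : (W.filter fun v => v ∈ S) ⊆ W.filter fun v => v ∈ V := by
    intro v hv
    rw [Finset.mem_filter] at hv ⊢
    exact ⟨hv.1, hSV hv.2⟩
  -- positivity of the real partition functions and the ratio
  have hpos : ∀ S' : Set HexVertex, 0 < Zloop H S' y := fun S' =>
    lt_of_lt_of_le one_pos (one_le_zloop hΩ hδ0 hy.1 S')
  have hne : ∀ S' : Set HexVertex, ((Zloop H S' y : ℝ) : ℂ) ≠ 0 := fun S' =>
    Complex.ofReal_ne_zero.2 (hpos S').ne'
  set r : ℝ := Zloop H (V \ Tγ) y * Zloop H S y / (Zloop H (S \ Tγ) y * Zloop H V y) with hr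
  have hrpos : 0 < r := div_pos (mul_pos (hpos _) (hpos _)) (mul_pos (hpos _) (hpos _))
  -- the ratio through the cluster expansion: `r = exp(sS - sV)`
  have hrC : (r : ℂ) = Complex.exp
      ((∑ C ∈ (W.filter fun v => v ∈ S).powerset.powerset with
          (C ∩ (W.filter fun v => v ∈ V).powerset.filter fun A => ∃ v ∈ A, v ∈ Tγ).Nonempty,
          truncatedWeight polyInc ρ C) -
        ∑ C ∈ (W.filter fun v => v ∈ V).powerset.powerset with
          (C ∩ (W.filter fun v => v ∈ V).powerset.filter fun A => ∃ v ∈ A, v ∈ Tγ).Nonempty,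
          truncatedWeight polyInc ρ C) := by
    have h1 : (r : ℂ) = (((Zloop H (V \ Tγ) y : ℝ) : ℂ) / ((Zloop H V y : ℝ) : ℂ)) /
        ((((Zloop H (S \ Tγ) y : ℝ) : ℂ)) / ((Zloop H S y : ℝ) : ℂ)) := by
      rw [hr]
      push_cast
      field_simp [hne (V \ Tγ), hne V, hne (S \ Tγ), hne S]
    rw [h1, hZ (V \ Tγ), hZ V, hZ (S \ Tγ), hZ S, powerset_filter_mem_diff W V Tγ,
      powerset_filter_mem_diff W S Tγ,
      powerset_sdiff_filter_eq_of_subset hTST (fun A => ∃ v ∈ A, v ∈ Tγ),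
      polymerPartitionFunction_sdiff_div_eq_exp (hsmall.isKPVolume _),
      polymerPartitionFunction_sdiff_div_eq_exp (hsmall.isKPVolume _), ← Complex.exp_sub]
    ring_nf
  -- abbreviate the two cluster sums
  obtain ⟨sV, hsV⟩ : ∃ sV : ℂ, sV = ∑ C ∈ (W.filter fun v => v ∈ V).powerset.powerset with
      (C ∩ (W.filter fun v => v ∈ V).powerset.filter fun A => ∃ v ∈ A, v ∈ Tγ).Nonempty,
      truncatedWeight polyInc ρ C := ⟨_, rfl⟩
  obtain ⟨sS, hsS⟩ : ∃ sS : ℂ, sS = ∑ C ∈ (W.filter fun v => v ∈ S).powerset.powerset with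
      (C ∩ (W.filter fun v => v ∈ V).powerset.filter fun A => ∃ v ∈ A, v ∈ Tγ).Nonempty,
      truncatedWeight polyInc ρ C := ⟨_, rfl⟩
  rw [← hsV, ← hsS] at hrC
  have hlog : Real.log r = (sS - sV).re := by
    have hnorm : r = Real.exp (sS - sV).re := by
      rw [← Complex.norm_exp, ← hrC, Complex.norm_real, Real.norm_eq_abs, abs_of_pos hrpos]
    rw [hnorm, Real.log_exp]
  -- the difference of the two cluster sums: clusters meeting `T` with a polymer not inside `S`
  have hsub : ((W.filter fun v => v ∈ S).powerset.powerset.filter fun C =>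
      (C ∩ (W.filter fun v => v ∈ V).powerset.filter fun A => ∃ v ∈ A, v ∈ Tγ).Nonempty) ⊆
      (W.filter fun v => v ∈ V).powerset.powerset.filter fun C =>
        (C ∩ (W.filter fun v => v ∈ V).powerset.filter fun A => ∃ v ∈ A, v ∈ Tγ).Nonempty :=
    Finset.filter_subset_filter _ (Finset.powerset_mono.2 (Finset.powerset_mono.2 hTST))
  have hdiff : sV - sS = ∑ C ∈ ((W.filter fun v => v ∈ V).powerset.powerset.filter fun C =>
      (C ∩ (W.filter fun v => v ∈ V).powerset.filter fun A => ∃ v ∈ A, v ∈ Tγ).Nonempty) \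
      ((W.filter fun v => v ∈ S).powerset.powerset.filter fun C =>
        (C ∩ (W.filter fun v => v ∈ V).powerset.filter fun A => ∃ v ∈ A, v ∈ Tγ).Nonempty),
      truncatedWeight polyInc ρ C := by
    rw [Finset.sum_sdiff_eq_sub hsub, hsV, hsS]
  -- finiteness of `V ∖ S`
  have hVfin : (V \ S).Finite :=
    ((finite_embMeshVertices_hex hΩ hδ0).subset (SAW.embMeshDomain_subset hexGraph hexCenter _ _)).subset
      Set.sdiff_subset
  -- every cluster of the difference passes through some `v ∈ γ` and some `w ∈ V ∖ S`
  have hmeet : ∀ C ∈ ((W.filter fun v => v ∈ V).powerset.powerset.filter fun C =>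
      (C ∩ (W.filter fun v => v ∈ V).powerset.filter fun A => ∃ v ∈ A, v ∈ Tγ).Nonempty) \
      ((W.filter fun v => v ∈ S).powerset.powerset.filter fun C =>
        (C ∩ (W.filter fun v => v ∈ V).powerset.filter fun A => ∃ v ∈ A, v ∈ Tγ).Nonempty),
      ∃ v ∈ γ.walk.support.toFinset, ∃ w ∈ hVfin.toFinset, v ∈ clusterSupp C ∧ w ∈ clusterSupp C := by
    intro C hC
    simp only [Finset.mem_sdiff, Finset.mem_filter, Finset.mem_powerset, not_and] at hC
    obtain ⟨⟨hCV, A', hA'⟩, hCS⟩ := hC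
    obtain ⟨hA'C, hA'D⟩ := Finset.mem_inter.1 hA'
    obtain ⟨-, v, hvA', hvT⟩ := Finset.mem_filter.1 hA'D
    have hCS' : ¬ C ⊆ (W.filter fun v => v ∈ S).powerset := fun h => hCS h ⟨A', hA'⟩
    obtain ⟨A, hAC, hATS⟩ := Finset.not_subset.1 hCS'
    obtain ⟨w, hwA, hwTS⟩ := Finset.not_subset.1 (fun h => hATS (Finset.mem_powerset.2 h))
    have hwTV : w ∈ W.filter fun v => v ∈ V := Finset.mem_powerset.1 (hCV hAC) hwA
    rw [Finset.mem_filter] at hwTV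
    have hwS : w ∉ S := fun h => hwTS (Finset.mem_filter.2 ⟨hwTV.1, h⟩)
    exact ⟨v, List.mem_toFinset.2 hvT, w, hVfin.mem_toFinset.2 ⟨hwTV.2, hwS⟩,
      mem_clusterSupp.2 ⟨A', hA'C, hvA'⟩, mem_clusterSupp.2 ⟨A, hAC, hwA⟩⟩
  -- assemble
  rw [one_mul, hlog]
  calc |(sS - sV).re| ≤ ‖sS - sV‖ := Complex.abs_re_le_norm _
    _ = ‖sV - sS‖ := by rw [← norm_neg, neg_sub]
    _ ≤ ∑ C ∈ ((W.filter fun v => v ∈ V).powerset.powerset.filter fun C =>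
            (C ∩ (W.filter fun v => v ∈ V).powerset.filter fun A => ∃ v ∈ A, v ∈ Tγ).Nonempty) \
          ((W.filter fun v => v ∈ S).powerset.powerset.filter fun C =>
            (C ∩ (W.filter fun v => v ∈ V).powerset.filter fun A => ∃ v ∈ A, v ∈ Tγ).Nonempty),
          ‖truncatedWeight polyInc ρ C‖ := by
        rw [hdiff]
        exact norm_sum_le _ _
    _ ≤ ∑ v ∈ γ.walk.support.toFinset, ∑ w ∈ hVfin.toFinset,
          ∑ C ∈ (W.filter fun v => v ∈ V).powerset.powerset with (v ∈ clusterSupp C ∧ w ∈ clusterSupp C),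
            ‖truncatedWeight polyInc ρ C‖ :=
        sum_filter_meets_le_sum_sum (Finset.sdiff_subset.trans (Finset.filter_subset _ _)) _ _ _
          (fun _ => norm_nonneg _) hmeet
    _ ≤ ∑ v ∈ γ.walk.support.toFinset, ∑ w ∈ hVfin.toFinset,
          Real.exp (-((1 / 2) * (hexGraph.dist v w : ℝ))) :=
        Finset.sum_le_sum fun v _ => Finset.sum_le_sum fun w _ =>
          sum_norm_truncatedWeight_through_le hsmall hconn _ v w
    _ = ∑ v ∈ γ.walk.support.toFinset, ∑ᶠ w ∈ V \ S, Real.exp (-((1 / 2) * (hexGraph.dist v w : ℝ))) := by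
        refine Finset.sum_congr rfl fun v _ => ?_
        rw [finsum_mem_eq_finite_toFinset_sum _ hVfin]

end Summit.CriticalPhenomena.SAWScalingLimit.Theorems.SAWMassiveIsingTilt

end
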